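import Literature.Topology.FourManifolds.SubsphereSide
import Literature.Topology.FourManifolds.SubsphereMorse
import Literature.Topology.FourManifolds.SolidFunction
import Literature.Topology.FourManifolds.CollarFill
import Literature.Topology.FourManifolds.SchoenfliesConfig
import Literature.Topology.FourManifolds.HeightDictionary
import Literature.Topology.FourManifolds.GradientLikeCongr
import HarnessLib

/-!
# The inductive step of Alexander's theorem, I: the solid, the scales and the sub-sphere

Topic `Literature/Topology/FourManifolds`; top layer of the fact seat of Alexander's theorem
(`provefact-Literature.Topology.FourManifolds.SphereEmbedding.schoenflies_exists_ball`, Schultens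
(2014), Thm. 3.2.5), written under a take-the-blocker claim from the Cerf seat
(`Literature.Topology.FourManifolds.cerf_pi0DiffDisc_relBoundary_three`, whose source, Cerf (1968) Ch. III, is this
theorem).  **Everything in this file is proved; no definitions, no named facts.**

The printed inductive step (Schultens (2014), proof of Thm. 3.2.5, PDF p. 45) starts from a
smooth sphere `S` with Morse height, a regular level plane `H'` and an innermost level circle
`α ⊆ H' ∩ S`, which "separates `S` into two disks, `D₁`, `D₂`"; the piecewise smooth sphere
`S₁ = D ∪ D₂` (`D` the planar disc of `α`) is smoothed "in a way that introduces only one new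
critical point" and has fewer saddles.  The fact seat has normalised this situation
(`CircleNormalForm.exists_tubeNormalForm`: `α` the unit circle at height `0`, the sphere the
vertical unit cylinder near it, the defining function `σ(ρ² - 1)` on a tube) and built every
piece of the step in that normal form (`CappedBallData.StepNF`).  This file assembles, from a
**configuration in tube normal form** (`SchoenfliesConfig.Config G f` with
`G = σ(ρ² - 1)` on the tube) and its two discs (`StepDiscs.exists_discs`, taken as hypotheses so
that the caller may first reflect the picture), the data of the step up to the sub-sphere:

* §1 `SchoenfliesStep.exists_scale` — a scale `s` below any bound and off any finite set of
  forbidden values (the apex height `s` and the bowl height `3s/8` must avoid the critical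
  values of the height, to keep the height injective on critical sets);
* §2 `SchoenfliesStep.exists_stepNF` — the solid function `F_X` of the step
  (`SolidFunction.exists_solidFunction`: the ball side of the sphere, or its big-ball truncated
  complement, with extra zero set a far closed set `T₀`) satisfies `StepNF F_X (D₊ ∪ T₀) D₋`;
* §3 `SchoenfliesStep.exists_collarFill` — the collar fill `Φ_c` (`CappedBallLid.exists_diffeomorph_collarFill`)
  at all small rounding widths, and the filled embedding `Φ_c ∘ f` with the bookkeeping
  hypotheses (`hZ₁`, `hZ₂`, `hTW`, `hTu`) of `CappedBallLid.exists_subsphereParam` /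
  `CappedBallLid.exists_subSide`;
* §4 the sub-sphere `W` as an embedded sphere `f_B` with Morse height, its critical points
  (`SchoenfliesStep.isMCriticalPt_sub_iff`: the apex, or a critical point of the original height
  whose image lies on the absorbed disc `D₋`), its saddles
  (`SchoenfliesStep.image_saddles_sub`: the saddles over `D₋`), and the values of its height at
  critical points (`SchoenfliesStep.height_sub_critical`).

## References
* J. Schultens, *Introduction to 3-Manifolds*, GSM 151, AMS (2014), proof of Thm. 3.2.5 (PDF
  pp. 44–45).
* J. Cerf, *Sur les difféomorphismes de la sphère de dimension trois (Γ₄ = 0)*, LNM 53 (1968),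
  Ch. III (the smooth Schönflies theorem for `S² ⊂ ℝ³`).
-/

noncomputable section

open Set Metric Filter Topology Function Module
open scoped ContDiff RealInnerProductSpace Manifold

namespace Literature.Topology.FourManifolds.SchoenfliesStep

open CappedBallLid SchoenfliesConfig

/-! ### §1 The scale -/

/-- **Choice of the scale.**  Given the tube widths `w₀, η₀ > 0`, a bound `b > 0` and a finite
set `Λ` of forbidden values, there is a scale `s` with `0 < s ≤ 1/8`, `8s ≤ w₀`, `20s ≤ η₀`,
`s < b`, and `s ∉ Λ`, `3s/8 ∉ Λ`. [folklore] -/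
theorem exists_scale {w₀ η₀ b : ℝ} (hw₀ : 0 < w₀) (hη₀ : 0 < η₀) (hb : 0 < b) {Λ : Set ℝ}
    (hΛ : Λ.Finite) :
    ∃ s : ℝ, 0 < s ∧ s ≤ 1 / 8 ∧ 8 * s ≤ w₀ ∧ 20 * s ≤ η₀ ∧ s < b ∧ s ∉ Λ ∧ 3 * s / 8 ∉ Λ := by
  -- the admissible interval `(0, m)` is uncountable, the forbidden set is finite
  set m : ℝ := min (min (1 / 8) (w₀ / 8)) (min (η₀ / 20) b) with hm
  have hm0 : 0 < m := by positivity
  have hbad : (Λ ∪ (fun t => 8 * t / 3) '' Λ).Finite := hΛ.union (hΛ.image _)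
  have hinf : (Ioo (0 : ℝ) m).Infinite := Ioo_infinite hm0
  obtain ⟨s, hs, hsΛ⟩ : ∃ s ∈ Ioo (0 : ℝ) m, s ∉ Λ ∪ (fun t => 8 * t / 3) '' Λ :=
    (hinf.sdiff hbad).nonempty.imp fun s hs => ⟨hs.1, hs.2⟩
  have hsm : s < m := hs.2
  have h1 : m ≤ 1 / 8 := le_trans (min_le_left _ _) (min_le_left _ _)
  have h2 : m ≤ w₀ / 8 := le_trans (min_le_left _ _) (min_le_right _ _)
  have h3 : m ≤ η₀ / 20 := le_trans (min_le_right _ _) (min_le_left _ _)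
  have h4 : m ≤ b := le_trans (min_le_right _ _) (min_le_right _ _)
  refine ⟨s, hs.1, by linarith, by linarith, by linarith, by linarith, fun h => hsΛ (Or.inl h),
    fun h => hsΛ (Or.inr ⟨3 * s / 8, h, by ring⟩)⟩

/-! ### §2 The solid function and the normal form of the step -/

section Solid

variable {G : EuclideanSpace ℝ (Fin 3) → ℝ}
  {f : sphere (0 : EuclideanSpace ℝ (Fin 3)) 1 → EuclideanSpace ℝ (Fin 3)} {σ w₀ η₀ : ℝ}
  {Dup Dlow : Set (EuclideanSpace ℝ (Fin 3))}

/-- The closed box of scale `s ≤ w₀/8`, `6s ≤ η₀` lies in the tube `{ρ² ≤ (1+3w₀)², |x₂| ≤ η₀}`.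
[folklore] -/
theorem closedBox_subset_tube {s w₀ η₀ : ℝ} (hs : 0 < s) (hsw : 8 * s ≤ w₀) (hsη : 20 * s ≤ η₀) :
    closedBox s ⊆ {x | hsq x ≤ (1 + 3 * w₀) ^ 2 ∧ |x 2| ≤ η₀} := by
  rintro x ⟨h1, h2, h3⟩
  refine ⟨le_trans h1 ?_, abs_le.2 ⟨by linarith, by linarith⟩⟩
  have : 1 + 3 * s ≤ 1 + 3 * w₀ := by linarith
  exact pow_le_pow_left₀ (by linarith) this 2

/-- **The normal form of the step.**  For a configuration `(G, f)` in tube normal form with sign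
`σ` and discs `D₊`, `D₋` (the conclusions of `StepDiscs.exists_discs`), the solid function `F_X`
of `SolidFunction.exists_solidFunction` — zero set `f(𝕊²) ∪ T₀` with `T₀` closed and far — gives
normal-form data `StepNF F_X (D₊ ∪ T₀) D₋ w₀ η₀ ε₁`, with everything inside the ball of radius
`R₁` except `T₀`, which is outside. [cite: Schultens2014, proof of Thm. 3.2.5 (PDF p. 45)] -/
theorem exists_stepNF (hC : Config G f) (hσ : σ = 1 ∨ σ = -1) (hw₀ : 0 < w₀) (hη₀ : 0 < η₀)
    (hNF : ∀ x, hsq x ≤ (1 + 3 * w₀) ^ 2 → |x 2| ≤ η₀ → G x = σ * (hsq x - 1))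
    (hDupc : IsClosed Dup) (hDlowc : IsClosed Dlow) (hUnion : Dup ∪ Dlow = range f)
    (hInter : Dup ∩ Dlow = {x | hsq x = 1 ∧ x 2 = 0})
    (hUpBox : ∀ x ∈ Dup, hsq x ≤ (1 + 3 * w₀) ^ 2 → |x 2| ≤ η₀ → 0 ≤ x 2)
    (hLowBox : ∀ x ∈ Dlow, hsq x ≤ (1 + 3 * w₀) ^ 2 → |x 2| ≤ η₀ → x 2 ≤ 0) :
    ∃ (FX : EuclideanSpace ℝ (Fin 3) → ℝ) (T₀ : Set (EuclideanSpace ℝ (Fin 3))) (R₁ ε₁ : ℝ),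
      StepNF FX (Dup ∪ T₀) Dlow w₀ η₀ ε₁ ∧
      (∀ y, FX (f y) = 0) ∧ {x | FX x = 0} = range f ∪ T₀ ∧ IsClosed T₀ ∧ 0 < R₁ ∧
      (∀ x ∈ T₀, R₁ ≤ ‖x‖) ∧ (∀ x ∈ T₀, x ∉ range f) ∧ range f ⊆ ball 0 R₁ ∧
      {x | hsq x ≤ (1 + 3 * w₀) ^ 2 ∧ |x 2| ≤ η₀} ⊆ ball 0 R₁ := by
  obtain ⟨ε₀, hε₀, hK⟩ := hC.proper
  obtain ⟨FX, T₀, R₁, ε₁, hFXs, hε₁, hK₁, hregX, hNFX, hZX, hT₀c, hR₁, hT₀far, hK'R, htubeR, hT₀G⟩ :=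
    SolidFunction.exists_solidFunction hC.smooth hK hε₀ (fun x hx => hx) hC.reg hσ hw₀ hη₀ hNF
  have hrange : range f = {x | G x = 0} := hC.range_eq
  have hZ' : {x | FX x = 0} = range f ∪ T₀ := by rw [hZX, hrange]
  have hT₀range : ∀ x ∈ T₀, x ∉ range f := fun x hx hxr => by
    rw [hrange] at hxr; exact hT₀G x hx hxr
  have hrangeR : range f ⊆ ball 0 R₁ := fun x hx => by
    rw [hrange] at hx
    exact hK'R (show G x ≤ ε₀ by rw [show G x = 0 from hx]; exact hε₀.le)
  refine ⟨FX, T₀, R₁, ε₁, ?_, fun y => ?_, hZ', hT₀c, hR₁, hT₀far, hT₀range, hrangeR, htubeR⟩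
  · refine ⟨hFXs, hε₁, hK₁, hregX, hw₀, ?_, hDupc.union hT₀c, hDlowc, ?_, ?_, ?_, hLowBox⟩
    · -- `F_X = ρ² - 1` on the tube
      intro x h1 h2; exact hNFX x h1 h2
    · -- the zero set is `(D₊ ∪ T₀) ∪ D₋`
      rw [hZ', ← hUnion]; ext x; simp only [mem_union]; tauto
    · -- `(D₊ ∪ T₀) ∩ D₋ ⊆` the circle: `T₀` is far, `D₋` is in the ball
      rintro x ⟨hx₁ | hx₁, hx₂⟩
      · rw [← hInter]; exact ⟨hx₁, hx₂⟩
      · exfalso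
        have hxr : x ∈ range f := hUnion ▸ Or.inr hx₂
        have := hrangeR hxr
        rw [mem_ball_zero_iff] at this
        linarith [hT₀far x hx₁]
    · -- in the box `D₊ ∪ T₀` lies above height `0` (`T₀` misses the box)
      rintro x (hx | hx) h1 h2
      · exact hUpBox x hx h1 h2
      · exfalso
        have := htubeR ⟨h1, h2⟩
        rw [mem_ball_zero_iff] at this
        linarith [hT₀far x hx]
  · have : f y ∈ {x | FX x = 0} := by rw [hZ']; exact Or.inl (mem_range_self y)
    exact this

end Solid

/-! ### §3 The collar fill and the filled embedding -/

section Fill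

variable {FX : EuclideanSpace ℝ (Fin 3) → ℝ} {P : ℝ → ℝ} {E₁ E₂ : Set (EuclideanSpace ℝ (Fin 3))}
  {w₀ η₀ ε₁ s : ℝ}

/-- **The collar fill at scale `s`.**  Under the normal form and for an admissible positive
part, there is `δ₀ > 0` such that for every `0 < δ ≤ δ₀` one has the scales `StepScale s δ w₀ η₀`
and a diffeomorphism `Φ_c` of `ℝ³`, the identity off the closed box, carrying `{F_X ≤ 0}` and
`{F_X = 0}` to the sublevel and zero set of the filled function `F₂ = fillFun F_X P s δ M`.
[cite: Schultens2014, proof of Thm. 3.2.5 (PDF p. 45)] -/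
theorem exists_collarFill (hP : Admissible P) (hN : StepNF FX E₁ E₂ w₀ η₀ ε₁)
    (hs : 0 < s) (hs1 : s ≤ 1 / 8) (hsw : 8 * s ≤ w₀) (hsη : 20 * s ≤ η₀) :
    ∃ δ₀ : ℝ, 0 < δ₀ ∧ δ₀ < ε₁ ∧ ∀ δ, 0 < δ → δ ≤ δ₀ →
      StepScale s δ w₀ η₀ ∧
      ∃ Φ : EuclideanSpace ℝ (Fin 3) ≃ₘ⟮𝓘(ℝ, EuclideanSpace ℝ (Fin 3)),
          𝓘(ℝ, EuclideanSpace ℝ (Fin 3))⟯ EuclideanSpace ℝ (Fin 3),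
        Φ '' {x | FX x ≤ 0} = {x | fillFun FX P s δ ((1 + s) ^ 2 + ε₁ + 2) x ≤ 0} ∧
        Φ '' {x | FX x = 0} = {x | fillFun FX P s δ ((1 + s) ^ 2 + ε₁ + 2) x = 0} ∧
        ∀ x, x ∉ closedBox s → Φ x = x := by
  have hNFa : ∀ x, |hsq x - 1| ≤ w₀ → |x 2| ≤ η₀ → FX x = hsq x - 1 := by
    intro x h1 h2
    refine hN.hNF x ?_ h2
    have hw₀ := hN.hw₀
    have : hsq x ≤ 1 + w₀ := by linarith [(abs_le.1 h1).2]
    nlinarith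
  have hNFb : ∀ x, hsq x < 1 → |x 2| ≤ η₀ → FX x < 0 := by
    intro x h1 h2
    have hw₀ := hN.hw₀
    have h0 : 0 ≤ hsq x := by unfold hsq; positivity
    rw [hN.hNF x (by nlinarith) h2]; linarith
  obtain ⟨δ₀, hδ₀, hδ₀ε, hΦ⟩ := exists_diffeomorph_collarFill (P := P) hP.hP hP.hP0 hP.hP1 hP.hPd hP.hPge
    hP.hPle hN.hF hN.hε₀ hN.hKε hN.hreg hs hs1 hsw (by linarith) hNFa hNFb
  refine ⟨min δ₀ (s / 16), lt_min hδ₀ (by positivity), lt_of_le_of_lt (min_le_left _ _) hδ₀ε,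
    fun δ hδ hδle => ?_⟩
  obtain ⟨Φ, h1, h2, h3⟩ := hΦ δ hδ (le_trans hδle (min_le_left _ _))
  exact ⟨⟨hs, hs1, hsw, hsη, hδ, le_trans hδle (min_le_right _ _)⟩, Φ, h1, h2,
    fun x hx => h3 x (by simpa [closedBox] using hx)⟩

variable {δ : ℝ} {f : sphere (0 : EuclideanSpace ℝ (Fin 3)) 1 → EuclideanSpace ℝ (Fin 3)}
  {T₀ : Set (EuclideanSpace ℝ (Fin 3))} {R₁ : ℝ}

/-- **The sub-sphere lies in the ball of radius `R₁`** containing the closed box and the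
absorbed disc. [folklore] -/
theorem norm_lt_of_mem_subSphere (hP : Admissible P) (hN : StepNF FX E₁ E₂ w₀ η₀ ε₁)
    (hS : StepScale s δ w₀ η₀)
    (htubeR : {x | hsq x ≤ (1 + 3 * w₀) ^ 2 ∧ |x 2| ≤ η₀} ⊆ ball 0 R₁) (hE₂R : E₂ ⊆ ball 0 R₁)
    {w : EuclideanSpace ℝ (Fin 3)} (hw : w ∈ subSphere FX P E₁ s δ ε₁) : ‖w‖ < R₁ := by
  obtain ⟨hs, -, hsw, hsη, -, -⟩ := scales hS
  rcases mem_closedBox_or_of_mem_subSphere hP hN hS hw with ⟨hwB, -, -⟩ | ⟨hwE₂, -⟩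
  · exact mem_ball_zero_iff.1 (htubeR (closedBox_subset_tube hs hsw hsη hwB))
  · exact mem_ball_zero_iff.1 (hE₂R hwE₂)

/-- **Bookkeeping of the filled embedding.**  With `Φ_c` the collar fill and `T = Φ_c(T₀)`:
the filled embedding `Φ_c ∘ f` maps into the zero set of the filled function (`hZ₁`), whose other
zeros lie on `T` (`hZ₂`); the sub-sphere misses `T` (`hTW`) and so does the upper wall point
`(1, 0, s)` (`hTu`). [cite: Schultens2014, proof of Thm. 3.2.5 (PDF p. 45)] -/
theorem fill_bookkeeping (hP : Admissible P) (hN : StepNF FX E₁ E₂ w₀ η₀ ε₁) (hS : StepScale s δ w₀ η₀)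
    (hfZ : ∀ y, FX (f y) = 0) (hZ : {x | FX x = 0} = range f ∪ T₀)
    (hT₀far : ∀ x ∈ T₀, R₁ ≤ ‖x‖)
    (htubeR : {x | hsq x ≤ (1 + 3 * w₀) ^ 2 ∧ |x 2| ≤ η₀} ⊆ ball 0 R₁) (hE₂R : E₂ ⊆ ball 0 R₁)
    (Φ : EuclideanSpace ℝ (Fin 3) ≃ₘ⟮𝓘(ℝ, EuclideanSpace ℝ (Fin 3)),
      𝓘(ℝ, EuclideanSpace ℝ (Fin 3))⟯ EuclideanSpace ℝ (Fin 3))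
    (hΦZ : Φ '' {x | FX x = 0} = {x | fillFun FX P s δ ((1 + s) ^ 2 + ε₁ + 2) x = 0})
    (hΦid : ∀ x, x ∉ closedBox s → Φ x = x) :
    (∀ t ∈ T₀, Φ t = t) ∧
    (∀ y, fillFun FX P s δ ((1 + s) ^ 2 + ε₁ + 2) (Φ (f y)) = 0) ∧
    (∀ x, fillFun FX P s δ ((1 + s) ^ 2 + ε₁ + 2) x = 0 → x ∉ T₀ → x ∈ range (Φ ∘ f)) ∧
    (∀ x ∈ subSphere FX P E₁ s δ ε₁, x ∉ T₀) ∧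
    EuclideanSpace.single (0 : Fin 3) (1 : ℝ) + s • EuclideanSpace.single (2 : Fin 3) (1 : ℝ) ∉ T₀ := by
  obtain ⟨hs, hs1, hsw, hsη, -, -⟩ := scales hS
  -- `T₀` misses the closed box, so `Φ` fixes it pointwise
  have hT₀box : ∀ t ∈ T₀, t ∉ closedBox s := fun t ht htB => by
    have := mem_ball_zero_iff.1 (htubeR (closedBox_subset_tube hs hsw hsη htB))
    linarith [hT₀far t ht]
  have hΦT : ∀ t ∈ T₀, Φ t = t := fun t ht => hΦid t (hT₀box t ht)
  refine ⟨hΦT, fun y => ?_, fun x hx hxT => ?_, fun x hx hxT => ?_, fun hT => ?_⟩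
  · have : Φ (f y) ∈ Φ '' {x | FX x = 0} := ⟨f y, hfZ y, rfl⟩
    rw [hΦZ] at this; exact this
  · have hx' : x ∈ Φ '' {x | FX x = 0} := by rw [hΦZ]; exact hx
    obtain ⟨z, hz, rfl⟩ := hx'
    rw [hZ] at hz
    rcases hz with ⟨y, rfl⟩ | hzT
    · exact ⟨y, rfl⟩
    · exact absurd (by rwa [hΦT z hzT] at hxT) (not_not.2 hzT)
  · have h := norm_lt_of_mem_subSphere hP hN hS htubeR hE₂R hx
    linarith [hT₀far x hxT]
  · have hmem : EuclideanSpace.single (0 : Fin 3) (1 : ℝ) + s • EuclideanSpace.single (2 : Fin 3) (1 : ℝ) ∈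
        {x : EuclideanSpace ℝ (Fin 3) | hsq x ≤ (1 + 3 * w₀) ^ 2 ∧ |x 2| ≤ η₀} := by
      have hw₀ := hN.hw₀
      have h0 : hsq (EuclideanSpace.single (0 : Fin 3) (1 : ℝ) + s • EuclideanSpace.single (2 : Fin 3) (1 : ℝ)) = 1 := by
        simp [hsq]
      have h2 : (EuclideanSpace.single (0 : Fin 3) (1 : ℝ) + s • EuclideanSpace.single (2 : Fin 3) (1 : ℝ)) 2 = s := by
        simp
      refine ⟨?_, ?_⟩
      · rw [h0]; nlinarith
      · rw [h2, abs_of_pos hs]; linarith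
    have := mem_ball_zero_iff.1 (htubeR hmem)
    linarith [hT₀far _ hT]

end Fill

/-! ### §4 The Morse data of the sub-sphere -/

section SubMorse

variable {FX : EuclideanSpace ℝ (Fin 3) → ℝ} {P : ℝ → ℝ} {E₁ E₂ : Set (EuclideanSpace ℝ (Fin 3))}
  {w₀ η₀ ε₁ s δ : ℝ}
  {f fB : sphere (0 : EuclideanSpace ℝ (Fin 3)) 1 → EuclideanSpace ℝ (Fin 3)}

/-- The height direction `e₂` is nonzero. [folklore] -/
theorem e₂_ne_zero : EuclideanSpace.single (2 : Fin 3) (1 : ℝ) ≠ 0 := by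
  intro h
  have := congrArg (fun w : EuclideanSpace ℝ (Fin 3) => w 2) h
  simp at this

/-- `height f` is the inner product with `e₂`. [folklore] -/
theorem height_eq (g : sphere (0 : EuclideanSpace ℝ (Fin 3)) 1 → EuclideanSpace ℝ (Fin 3)) :
    height g = fun y => ⟪EuclideanSpace.single (2 : Fin 3) (1 : ℝ), g y⟫ := rfl

/-- A point of `ℝ³` with coordinates `(0, 0, s)` is `s • e₂`. [folklore] -/
theorem eq_apex_of_coords {x : EuclideanSpace ℝ (Fin 3)} (h0 : x 0 = 0) (h1 : x 1 = 0) (h2 : x 2 = s) :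
    x = s • EuclideanSpace.single (2 : Fin 3) (1 : ℝ) := by
  ext i
  fin_cases i <;> simp [h0, h1, h2]

variable (hP : Admissible P) (hN : StepNF FX E₁ E₂ w₀ η₀ ε₁) (hS : StepScale s δ w₀ η₀)
  (hf : Manifold.IsSmoothEmbedding (𝓡 2) 𝓘(ℝ, EuclideanSpace ℝ (Fin 3)) ∞ f)
  (hfZ : ∀ y, FX (f y) = 0) (hE₂ : E₂ ⊆ range f)
  (hfB : Manifold.IsSmoothEmbedding (𝓡 2) 𝓘(ℝ, EuclideanSpace ℝ (Fin 3)) ∞ fB)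
  (hWB : range fB = subSphere FX P E₁ s δ ε₁)
include hP hN hS hf hfZ hE₂ hfB hWB

/-- **The height of the sub-sphere is Morse** if the height of the sphere is
(`CappedBallLid.isMorse_sub` in the `Config` vocabulary). [cite: Schultens2014, proof of Thm. 3.2.5 (PDF p. 45)] -/
theorem isMorse_height_sub (hMorse : IsMorse (𝓡 2) (height f)) : IsMorse (𝓡 2) (height fB) :=
  isMorse_sub hP hN hS hf hfZ hE₂ hMorse hfB hWB

/-- **The critical points of the height on the sub-sphere**: `y` is critical iff `f_B y` is the
apex `(0, 0, s)`, or `f_B y = f y'` for a critical point `y'` of the original height with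
`f y'` on the absorbed disc `E₂` (and then off the closed box).
[cite: Schultens2014, proof of Thm. 3.2.5 (PDF p. 45)] -/
theorem isMCriticalPt_sub_iff (y : sphere (0 : EuclideanSpace ℝ (Fin 3)) 1) :
    IsMCriticalPt (𝓡 2) (height fB) y ↔
      ((fB y) 0 = 0 ∧ (fB y) 1 = 0 ∧ (fB y) 2 = s) ∨
        ∃ y', f y' = fB y ∧ f y' ∈ E₂ ∧ f y' ∉ closedBox s ∧ IsMCriticalPt (𝓡 2) (height f) y' := by
  have hdim : Module.finrank ℝ (EuclideanSpace ℝ (Fin 3)) = 2 + 1 := by simp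
  have hGBs : ContDiff ℝ ∞ (subFun FX P s δ ((1 + s) ^ 2 + ε₁ + 2)) := contDiff_subFun hN.hF hP.hP
  have hmemW : ∀ y, fB y ∈ subSphere FX P E₁ s δ ε₁ := fun y => by rw [← hWB]; exact mem_range_self y
  -- the two dictionaries: critical ⇔ horizontal
  have hcritB := HeightDictionary.criticalSet_inner_comp_eq_preimage (M := sphere (0 : EuclideanSpace ℝ (Fin 3)) 1)
    hdim (f := fB) (fun x => (hfB.contMDiff.mdifferentiableAt (by simp)))
    (fun x => injective_mfderiv_of_isImmersionAt' (hfB.isImmersion.isImmersionAt x))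
    (F := subFun FX P s δ ((1 + s) ^ 2 + ε₁ + 2)) (fun x => (hGBs.differentiable (by simp)) _)
    (fun y => (hmemW y).2) (fun y => fderiv_subFun_ne_zero_of_mem hP hN hS (hmemW y)) e₂_ne_zero
  have hcrit := HeightDictionary.criticalSet_inner_comp_eq_preimage (M := sphere (0 : EuclideanSpace ℝ (Fin 3)) 1)
    hdim (f := f) (fun x => (hf.contMDiff.mdifferentiableAt (by simp)))
    (fun x => injective_mfderiv_of_isImmersionAt' (hf.isImmersion.isImmersionAt x))
    (F := FX) (fun x => (hN.hF.differentiable (by simp)) _)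
    hfZ (fun y => hN.hreg _ (hfZ y)) e₂_ne_zero
  have hcB : ∀ z, IsMCriticalPt (𝓡 2) (height fB) z ↔
      ∃ c : ℝ, fderiv ℝ (subFun FX P s δ ((1 + s) ^ 2 + ε₁ + 2)) (fB z) =
        c • innerSL ℝ (EuclideanSpace.single (2 : Fin 3) (1 : ℝ)) := fun z => by
    rw [height_eq]; exact Set.ext_iff.1 hcritB z
  have hc : ∀ z, IsMCriticalPt (𝓡 2) (height f) z ↔
      ∃ c : ℝ, fderiv ℝ FX (f z) = c • innerSL ℝ (EuclideanSpace.single (2 : Fin 3) (1 : ℝ)) := fun z => by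
    rw [height_eq]; exact Set.ext_iff.1 hcrit z
  rw [hcB, horizontal_iff hP hN hS (hmemW y)]
  constructor
  · rintro (h | ⟨hyE₂, hyB, c, hc'⟩)
    · exact Or.inl h
    · obtain ⟨y', hy'⟩ := hE₂ hyE₂
      refine Or.inr ⟨y', hy', hy' ▸ hyE₂, hy' ▸ hyB, (hc y').2 ⟨c, ?_⟩⟩
      rw [hy']; exact hc'
  · rintro (h | ⟨y', hy', hyE₂, hyB, hcrit'⟩)
    · exact Or.inl h
    · obtain ⟨c, hc'⟩ := (hc y').1 hcrit'
      exact Or.inr ⟨hy' ▸ hyE₂, hy' ▸ hyB, c, hy' ▸ hc'⟩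

omit hP hE₂ hfB hWB in
/-- A horizontal zero of `F_X` on the sphere lies off the closed box. [folklore] -/
theorem not_mem_closedBox_of_isMCriticalPt {y : sphere (0 : EuclideanSpace ℝ (Fin 3)) 1}
    (hy : IsMCriticalPt (𝓡 2) (height f) y) : f y ∉ closedBox s := by
  have hdim : Module.finrank ℝ (EuclideanSpace ℝ (Fin 3)) = 2 + 1 := by simp
  have hcrit := HeightDictionary.criticalSet_inner_comp_eq_preimage (M := sphere (0 : EuclideanSpace ℝ (Fin 3)) 1)
    hdim (f := f) (fun x => (hf.contMDiff.mdifferentiableAt (by simp)))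
    (fun x => injective_mfderiv_of_isImmersionAt' (hf.isImmersion.isImmersionAt x))
    (F := FX) (fun x => (hN.hF.differentiable (by simp)) _)
    hfZ (fun y => hN.hreg _ (hfZ y)) e₂_ne_zero
  have : y ∈ criticalSet (𝓡 2) (height f) := hy
  rw [height_eq, hcrit] at this
  exact (horizontal_mem_iff hN hS (hfZ y) this).1

/-- **The saddles of the sub-sphere are the saddles over the absorbed disc.**  The image under
`f_B` of the index-`1` critical set of `height f_B` is the image under `f` of the set of
index-`1` critical points `y'` of `height f` with `f y' ∈ E₂`
(`CappedBallLid.saddleSet_eq` read through `HeightDictionary`).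
[cite: Schultens2014, proof of Thm. 3.2.5 (PDF p. 45)] -/
theorem image_saddles_sub (hMorse : IsMorse (𝓡 2) (height f)) :
    fB '' criticalSetOfIndex (𝓡 2) (height fB) 1 =
      f '' {y' | y' ∈ criticalSetOfIndex (𝓡 2) (height f) 1 ∧ f y' ∈ E₂} := by
  have hdim : Module.finrank ℝ (EuclideanSpace ℝ (Fin 3)) = 2 + 1 := by simp
  have hdim3 : Module.finrank ℝ (EuclideanSpace ℝ (Fin 3)) = 3 := by simp
  have hGBs : ContDiff ℝ ∞ (subFun FX P s δ ((1 + s) ^ 2 + ε₁ + 2)) := contDiff_subFun hN.hF hP.hP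
  have hmemW : ∀ y, fB y ∈ subSphere FX P E₁ s δ ε₁ := fun y => by rw [← hWB]; exact mem_range_self y
  have hinjf := fun x => injective_mfderiv_of_isImmersionAt' (hf.isImmersion.isImmersionAt x)
  have hinjfB := fun x => injective_mfderiv_of_isImmersionAt' (hfB.isImmersion.isImmersionAt x)
  have hregf : ∀ y, fderiv ℝ FX (f y) ≠ 0 := fun y => hN.hreg _ (hfZ y)
  have hregfB : ∀ y, fderiv ℝ (subFun FX P s δ ((1 + s) ^ 2 + ε₁ + 2)) (fB y) ≠ 0 := fun y =>
    fderiv_subFun_ne_zero_of_mem hP hN hS (hmemW y)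
  have hMorseB : IsMorse (𝓡 2) (height fB) := isMorse_sub hP hN hS hf hfZ hE₂ hMorse hfB hWB
  -- Morse-ness in `F`-terms (the `hsep` hypotheses)
  have hsepF := (HeightDictionary.isMorse_inner_comp_iff hdim hf.contMDiff hinjf
    (hN.hF.of_le (by norm_cast)) hfZ hregf e₂_ne_zero).1 hMorse
  have hsepB := (HeightDictionary.isMorse_inner_comp_iff hdim hfB.contMDiff hinjfB
    (hGBs.of_le (by norm_cast)) (fun y => (hmemW y).2) hregfB e₂_ne_zero).1 hMorseB
  have hSB := HeightDictionary.criticalSetOfIndex_one_eq_preimage (M := sphere (0 : EuclideanSpace ℝ (Fin 3)) 1)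
    hdim3 hfB.contMDiff hinjfB (hGBs.of_le (by norm_cast)) (fun y => (hmemW y).2) hregfB e₂_ne_zero hsepB
  have hSf := HeightDictionary.criticalSetOfIndex_one_eq_preimage (M := sphere (0 : EuclideanSpace ℝ (Fin 3)) 1)
    hdim3 hf.contMDiff hinjf (hN.hF.of_le (by norm_cast)) hfZ hregf e₂_ne_zero hsepF
  have hSS := saddleSet_eq hP hN hS (F := FX) (E₁ := E₁) (E₂ := E₂) (ε₀ := ε₁)
  rw [height_eq, height_eq, hSB, hSf, image_preimage_eq_inter_range, hWB]
  ext p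
  constructor
  · rintro ⟨hpA, hpW⟩
    obtain ⟨⟨hpE₂, -⟩, hpS⟩ := (Set.ext_iff.1 hSS p).1 ⟨hpW, hpA⟩
    obtain ⟨y', hy'⟩ := hE₂ hpE₂
    exact ⟨y', ⟨by rw [mem_preimage, hy']; exact hpS, by rw [hy']; exact hpE₂⟩, hy'⟩
  · rintro ⟨y', ⟨hy'S, hy'E₂⟩, rfl⟩
    have hB : f y' ∉ closedBox s := (horizontal_mem_iff hN hS (hfZ y') hy'S.1).1
    have hp := (Set.ext_iff.1 hSS (f y')).2 ⟨⟨hy'E₂, hB⟩, hy'S⟩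
    exact ⟨hp.2, hp.1⟩

/-- **The number of saddles of the sub-sphere** is the number of saddles of the original height
over the absorbed disc. [cite: Schultens2014, proof of Thm. 3.2.5 (PDF p. 45)] -/
theorem saddles_sub_eq (hMorse : IsMorse (𝓡 2) (height f)) :
    saddles fB = {y' | y' ∈ criticalSetOfIndex (𝓡 2) (height f) 1 ∧ f y' ∈ E₂}.ncard := by
  unfold saddles
  rw [← Set.ncard_image_of_injective _ hfB.isEmbedding.injective, image_saddles_sub hP hN hS hf hfZ hE₂ hfB hWB hMorse,
    Set.ncard_image_of_injective _ hf.isEmbedding.injective]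

/-- **Heights of the sub-sphere's critical points.**  At a critical point the height of the
sub-sphere is either the apex height `s` or a critical value of the original height, attained at
a critical point over the absorbed disc. [cite: Schultens2014, proof of Thm. 3.2.5 (PDF p. 45)] -/
theorem height_sub_critical {y : sphere (0 : EuclideanSpace ℝ (Fin 3)) 1}
    (hy : IsMCriticalPt (𝓡 2) (height fB) y) :
    (fB y = s • EuclideanSpace.single (2 : Fin 3) (1 : ℝ) ∧ height fB y = s) ∨
      ∃ y', f y' = fB y ∧ f y' ∈ E₂ ∧ IsMCriticalPt (𝓡 2) (height f) y' ∧ height fB y = height f y' := by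
  rcases (isMCriticalPt_sub_iff hP hN hS hf hfZ hE₂ hfB hWB y).1 hy with ⟨h0, h1, h2⟩ | ⟨y', hy', hyE₂, -, hc⟩
  · exact Or.inl ⟨eq_apex_of_coords h0 h1 h2, by rw [height_apply, h2]⟩
  · exact Or.inr ⟨y', hy', hyE₂, hc, by rw [height_apply, height_apply, hy']⟩

/-- **Injectivity of the height on the critical set passes to the sub-sphere** as soon as the
apex height `s` is not a critical value of the original height.
[cite: Schultens2014, proof of Thm. 3.2.5 (PDF p. 45)] -/
theorem injOn_height_sub (hinj : InjOn (height f) (criticalSet (𝓡 2) (height f)))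
    (hsv : ∀ y', IsMCriticalPt (𝓡 2) (height f) y' → height f y' ≠ s) :
    InjOn (height fB) (criticalSet (𝓡 2) (height fB)) := by
  intro y₁ hy₁ y₂ hy₂ heq
  apply hfB.isEmbedding.injective
  rcases height_sub_critical hP hN hS hf hfZ hE₂ hfB hWB hy₁ with ⟨h₁, hv₁⟩ | ⟨y₁', hy₁', -, hc₁, hv₁⟩ <;>
    rcases height_sub_critical hP hN hS hf hfZ hE₂ hfB hWB hy₂ with ⟨h₂, hv₂⟩ | ⟨y₂', hy₂', -, hc₂, hv₂⟩
  · rw [h₁, h₂]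
  · exact absurd (by rw [← hv₂, ← heq, hv₁]) (hsv y₂' hc₂)
  · exact absurd (by rw [← hv₁, heq, hv₂]) (hsv y₁' hc₁)
  · have : y₁' = y₂' := hinj hc₁ hc₂ (by rw [← hv₁, heq, hv₂])
    rw [← hy₁', ← hy₂', this]

end SubMorse

end Literature.Topology.FourManifolds.SchoenfliesStep
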